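import Summits.BirchSwinnertonDyer.BirchSwinnertonDyer.Theorems.SignedBaseChangeAnticyclotomicEisensteinDivisibilitySpecializationLength
import Literature.NumberTheory.EllipticCurves.Rubin1991.TwoVariableMainConjecture
import Mathlib.RingTheory.Nakayama
import Mathlib.LinearAlgebra.Matrix.Charpoly.LinearMap
import HarnessLib

/-!
# The LINE LIFT over `Λ₂ = ℤ_p⟦T₂⟧⟦T₁⟧`: a finite double layer `M/(p, T₂)M` (or `M/(p, T₁)M`) forces
# `M` to be `Λ₂`-TORSION with `μ_{Λ₂}(M) = 0` — the torsion conjunct of O2 / R0T and the `μ = 0` clause of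
# R_μ / RES2 from ONE line (crux `BDPSelmerLowerDivisibilityAtTwo`, stmt-BirchSwinnertonDyer-24728; route
# `TwoAdicConverse`, rung S3)

Helper file `--supports stmt-BirchSwinnertonDyer-24728` (seat `bsd-2adic-tower-1` GEN 45; pen RC-552 «attackable next
without print: ALG2 … `--supports 24728`»; line card `Lines/two_variable_gv_squeeze_two.md` §R «R_μ: `μ_{Λ₂}(M) = 0` from
`μ = 0` on ONE line — ATTACKABLE (kernel algebra M)», «R0: torsion of `X_Gr₂`»; line card
`Lines/special_fibre_square_two.md` «RES2 gives the TORSION conjunct of O2, `μ(X_Gr) = 0` … for free»). THEOREMS ONLY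
(no definition, no named fact, no instance, no `sorry`); pure commutative algebra plus two instantiations; any prime `p`.

THE LEMMA. Let `M` be a finitely generated module over `Λ₂ = IwasawaAlgebra₂ p = ℤ_p⟦T₂⟧⟦T₁⟧` (outer variable
`T₁ = X`, inner variable `T₂ = C X`, `p = C (C p)`). If the double layer `M/(p, T₂)M` is FINITE, then some
`h ∈ Λ₂` with `h ∉ (p, T₂)` kills `M`; hence `M` is `Λ₂`-torsion, `M_{(p)} = 0` (i.e. `μ_{Λ₂}(M) = 0`:
`lengthAt Λ₂ M (p) = 0`), `ch_{Λ₂}(M) ⊄ (p)`, and every generator `C₀` of `ch_{Λ₂}(M)` is residually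
non-zero along any coefficient map `J : ℤ_p → 𝒪_{ℂ_p}` (`red(toUnr₂ J C₀) ≠ 0` in `𝔽̄_p⟦T₁⟧⟦T₂⟧` — the first conjunct of
seat 2's `GreenbergResidualEqualityForallAt`). The same along the other coordinate line `(p, T₁)`.

WHY IT IS THE RIGHT INTERFACE. `M/(p, T₂)M` finite ⟸ [`M/T₂M → X_line` with finite kernel] ∧ [`X_line` a finitely generated
torsion `Λ₁`-module with `μ = 0`, i.e. finitely generated over `ℤ_p`] — so two-variable TORSION and `μ₂ = 0` become
CERTIFIABLE from one line's torsion + `μ = 0` after a control step; no two-variable structure theory, no residual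
dévissage, no pseudo-null hypothesis. (The converse fails: `Λ₂/(T₂)` is torsion with `μ₂ = 0` and infinite double
layer — the hypothesis is «torsion AND `μ = 0` on the line», as the cards say.) Finite generation of `M` is necessary
(`Frac Λ₂` has double layer `0`).

PROOF (generic, §1, any commutative ring `R`, ideal `𝔞`, `y ∈ Jac R` with `yᴺ ∉ 𝔞` for all `N`):
(i) `M/𝔞M` finite ⇒ the chain `yⁿ·(M/𝔞M)` is eventually constant, and a stable term `P = y·P` is `0` by Nakayama
(`Submodule.eq_bot_of_le_smul_of_le_jacobson_bot`), so `yᵏM ⊆ 𝔞M`; (ii) Cayley–Hamilton for `φ = yᵏ·` with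
`φ(M) ⊆ 𝔞M` (Mathlib `LinearMap.exists_monic_and_natDegree_eq_and_coeff_mem_pow_and_aeval_eq_zero`, Matsumura 2.1) gives a
monic `q` with coefficients in powers of `𝔞` and `q(yᵏ)·M = 0`, and `q(yᵏ) ≡ y^{k·deg q} (mod 𝔞)`; (iii) so
`h := q(yᵏ) ∉ 𝔞` kills `M`. For `Λ₂`: `y = T₁`, `𝔞 = (p, T₂)`, and `T₁ᴺ ∉ (p, T₂)` because `Λ₂ → 𝔽_p⟦T⟧`,
`T₂ ↦ 0`, `p ↦ 0`, sends `T₁ᴺ ↦ Tᴺ ≠ 0` (§2). Consequences via the tree's local-length API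
(`LocalLength.lengthAt_eq_zero_of_forall_exists_notMem`, `LocalLength.lengthAt_ne_zero_of_charIdeal_le`) (§3). The
residual non-vanishing of a characteristic generator (`red(toUnr₂ J C₀) ≠ 0`) and the instantiation at
`X_Gr(E/K̃_∞) = WeierstrassCurve.XGr₂` are the companion file `…LineLiftResidual.lean` (same namespace).

Nothing about any elliptic curve is asserted beyond these implications; O2 and its research stubs stay OPEN; BSD is
proved for no curve. References: [Matsumura1987] Thm. 2.1 (Cayley–Hamilton), Thm. 2.2 (Nakayama); [Washington1997]
§13.2; Bourbaki AC VII §4.4.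
-/

-- D-0017: single-problem summit, the namespace repeats the problem name by design.
set_option linter.dupNamespace false
set_option autoImplicit false

noncomputable section

open scoped Classical

namespace Summit.BirchSwinnertonDyer.BirchSwinnertonDyer.Theorems.TwoAdicBDPLineLift

open NumberField IsDedekindDomain Literature.NumberTheory.EllipticCurves
  Literature.NumberTheory.EllipticCurves.Rubin1991
  Summit.BirchSwinnertonDyer.BirchSwinnertonDyer.Theorems.SignedBaseChangeAcDivSpecialization.LocalLength

universe u

/-! ## §1 Generic commutative algebra: an annihilator outside `𝔞` from a finite layer `M/𝔞M` -/

section Generic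

variable {R : Type*} [CommRing R] {M : Type*} [AddCommGroup M] [Module R M]

/-- **Finite layer ⇒ a power of a Jacobson element lands in it.** If `M/𝔞M` is finite and `y` lies in the
Jacobson radical of `R`, then `yᵏ M ⊆ 𝔞M` for some `k`: the chain `yⁿ·(M/𝔞M)` takes finitely many values, and a
stable term `P = y·P` vanishes by Nakayama. [cite: Matsumura1987, Thm. 2.2 (Nakayama)] -/
theorem exists_pow_smul_mem_of_finite_quotient (𝔞 : Ideal R) {y : R} (hy : y ∈ (⊥ : Ideal R).jacobson)
    [Finite (M ⧸ (𝔞 • (⊤ : Submodule R M)))] :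
    ∃ k : ℕ, ∀ m : M, y ^ k • m ∈ 𝔞 • (⊤ : Submodule R M) := by
  set Q := M ⧸ (𝔞 • (⊤ : Submodule R M))
  let f : ℕ → Submodule R Q := fun n => Ideal.span {y ^ n} • ⊤
  haveI : Finite (Submodule R Q) :=
    Finite.of_injective (fun N : Submodule R Q => (N : Set Q)) SetLike.coe_injective
  have hanti : ∀ i j : ℕ, i ≤ j → f j ≤ f i := fun i j hij =>
    Submodule.smul_mono_left (Ideal.span_singleton_le_span_singleton.mpr (pow_dvd_pow y hij))
  have hstep : ∀ a : ℕ, f (a + 1) = Ideal.span {y} • f a := fun a => by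
    simp only [f]
    rw [← Submodule.mul_smul, Ideal.span_singleton_mul_span_singleton, ← pow_succ']
  have hyJ : Ideal.span {y} ≤ (⊥ : Ideal R).jacobson :=
    (Ideal.span_singleton_le_iff_mem _).mpr hy
  -- a coincidence `f a = f b` with `a < b` forces `f a = ⊥`
  have key : ∀ a b : ℕ, a < b → f a = f b → f a = ⊥ := by
    intro a b hab hfab
    have hfa : f a = f (a + 1) := le_antisymm (hfab ▸ hanti _ _ hab) (hanti _ _ (Nat.le_succ a))
    have hfg : (f a).FG := ⟨(Set.toFinite (f a : Set Q)).toFinset, by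
      rw [Set.Finite.coe_toFinset]; exact Submodule.span_eq _⟩
    exact Submodule.eq_bot_of_le_smul_of_le_jacobson_bot (Ideal.span {y}) (f a) hfg
      (le_of_eq (hfa.trans (hstep a))) hyJ
  obtain ⟨n, n', hne, hfeq⟩ := Finite.exists_ne_map_eq_of_infinite f
  obtain ⟨k, hk⟩ : ∃ k, f k = ⊥ := by
    rcases lt_or_gt_of_ne hne with h | h
    · exact ⟨n, key n n' h hfeq⟩
    · exact ⟨n', key n' n h hfeq.symm⟩
  refine ⟨k, fun m => ?_⟩
  have hmem : y ^ k • (Submodule.Quotient.mk m : Q) ∈ f k :=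
    Submodule.smul_mem_smul (Ideal.mem_span_singleton_self _) Submodule.mem_top
  rw [hk, Submodule.mem_bot, ← Submodule.Quotient.mk_smul, Submodule.Quotient.mk_eq_zero] at hmem
  exact hmem

/-- **Cayley–Hamilton step.** If `M` is finitely generated and `yᵏ M ⊆ 𝔞M`, then some element
`y^N + a` with `a ∈ 𝔞` kills `M`: the endomorphism `yᵏ·` satisfies a monic polynomial `q` whose lower
coefficients lie in (powers of) `𝔞`, and `q(yᵏ) = y^{k·deg q} + a`. [cite: Matsumura1987, Thm. 2.1] -/
theorem exists_pow_add_smul_eq_zero_of_pow_smul_mem [Module.Finite R M] (𝔞 : Ideal R) (y : R) {k : ℕ}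
    (hk : ∀ m : M, y ^ k • m ∈ 𝔞 • (⊤ : Submodule R M)) :
    ∃ N : ℕ, ∃ a ∈ 𝔞, ∀ m : M, (y ^ N + a) • m = 0 := by
  set f : Module.End R M := Algebra.lsmul R R M (y ^ k) with hf
  have hrange : LinearMap.range f ≤ 𝔞 • ⊤ := by
    rintro _ ⟨m, rfl⟩
    exact hk m
  obtain ⟨q, hmonic, -, hcoeff, haeval⟩ :=
    LinearMap.exists_monic_and_natDegree_eq_and_coeff_mem_pow_and_aeval_eq_zero R f 𝔞 hrange
  refine ⟨k * q.natDegree, q.eval (y ^ k) - (y ^ k) ^ q.natDegree, ?_, fun m => ?_⟩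
  · rw [Polynomial.eval_eq_sum_range, Finset.sum_range_succ, hmonic.coeff_natDegree, one_mul,
      add_sub_cancel_right]
    refine 𝔞.sum_mem fun i hi => ?_
    have hi' : i < q.natDegree := Finset.mem_range.mp hi
    exact 𝔞.mul_mem_right _ (Ideal.pow_le_self (Nat.sub_ne_zero_of_lt hi') (hcoeff i))
  · have h1 : y ^ (k * q.natDegree) + (q.eval (y ^ k) - (y ^ k) ^ q.natDegree) = q.eval (y ^ k) := by
      rw [pow_mul]; ring
    have h2 : Polynomial.aeval f q = Algebra.lsmul R R M (q.eval (y ^ k)) := by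
      rw [hf, Polynomial.aeval_algHom_apply, ← Polynomial.coe_aeval_eq_eval]
    have h3 := congrArg (fun g : Module.End R M => g m) haeval
    simp only [h2, Algebra.lsmul_coe, LinearMap.zero_apply] at h3
    rw [h1]
    exact h3

/-- **The annihilator outside `𝔞`.** `M` finitely generated, `M/𝔞M` finite, `y ∈ Jac R` with no power in `𝔞`
⇒ some `h ∉ 𝔞` kills `M`. [cite: Matsumura1987, Thm. 2.1 and Thm. 2.2] -/
theorem exists_notMem_smul_eq_zero_of_finite_quotient [Module.Finite R M] (𝔞 : Ideal R) {y : R}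
    (hy : y ∈ (⊥ : Ideal R).jacobson) (hya : ∀ N : ℕ, y ^ N ∉ 𝔞)
    [Finite (M ⧸ (𝔞 • (⊤ : Submodule R M)))] :
    ∃ h : R, h ∉ 𝔞 ∧ ∀ m : M, h • m = 0 := by
  obtain ⟨k, hk⟩ := exists_pow_smul_mem_of_finite_quotient (M := M) 𝔞 hy
  obtain ⟨N, a, ha, hN⟩ := exists_pow_add_smul_eq_zero_of_pow_smul_mem (M := M) 𝔞 y hk
  refine ⟨y ^ N + a, fun hmem => hya N ?_, hN⟩
  have := 𝔞.sub_mem hmem ha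
  rwa [add_sub_cancel_right] at this

/-- A single annihilator outside the prime `𝔮` forces `M_𝔮 = 0`, i.e. local length `0` at `𝔮`. [folklore] -/
theorem lengthAt_eq_zero_of_smul_eq_zero_of_notMem [Module.Finite R M] (𝔮 : PrimeSpectrum R) {h : R}
    (hh : h ∉ 𝔮.asIdeal) (hM : ∀ m : M, h • m = 0) : Module.lengthAt R M 𝔮 = 0 :=
  lengthAt_eq_zero_of_forall_exists_notMem 𝔮 fun m => ⟨h, hh, by rw [hM m]; exact Submodule.zero_mem _⟩

/-- A single annihilator outside a HEIGHT-ONE prime `𝔮` forces `ch(M) ⊄ 𝔮`. [folklore] -/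
theorem not_charIdeal_le_of_smul_eq_zero_of_notMem [Module.Finite R M] {𝔮 : PrimeSpectrum R}
    (h𝔮 : 𝔮.asIdeal.height = 1) {h : R} (hh : h ∉ 𝔮.asIdeal) (hM : ∀ m : M, h • m = 0) :
    ¬ Module.charIdeal R M ≤ 𝔮.asIdeal := fun hle =>
  lengthAt_ne_zero_of_charIdeal_le h𝔮 hle (lengthAt_eq_zero_of_smul_eq_zero_of_notMem 𝔮 hh hM)

/-- A single NON-ZERO annihilator over a domain makes `M` a torsion module. [folklore] -/
theorem isTorsion_of_smul_eq_zero [IsDomain R] {h : R} (hh : h ≠ 0) (hM : ∀ m : M, h • m = 0) :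
    Module.IsTorsion R M := fun m => ⟨⟨h, mem_nonZeroDivisors_of_ne_zero hh⟩, hM m⟩

end Generic

/-! ## §2 `Λ₂ = ℤ_p⟦T₂⟧⟦T₁⟧`: the coordinate lines avoid the powers of the other variable -/

section TwoVar

variable (p : ℕ) [Fact p.Prime]

open PowerSeries

/-- `T₁ = X` lies in the Jacobson radical (= maximal ideal) of the local ring `Λ₂`. [folklore] -/
theorem X_mem_jacobson_bot :
    (X : IwasawaAlgebra₂ p) ∈ (⊥ : Ideal (IwasawaAlgebra₂ p)).jacobson := by
  rw [IsLocalRing.jacobson_eq_maximalIdeal ⊥ bot_ne_top, IsLocalRing.mem_maximalIdeal, mem_nonunits_iff,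
    PowerSeries.isUnit_iff_constantCoeff, PowerSeries.constantCoeff_X]
  exact not_isUnit_zero

/-- `T₂ = C X` lies in the Jacobson radical (= maximal ideal) of the local ring `Λ₂`. [folklore] -/
theorem C_X_mem_jacobson_bot :
    (C (X : IwasawaAlgebra p) : IwasawaAlgebra₂ p) ∈ (⊥ : Ideal (IwasawaAlgebra₂ p)).jacobson := by
  rw [IsLocalRing.jacobson_eq_maximalIdeal ⊥ bot_ne_top, IsLocalRing.mem_maximalIdeal, mem_nonunits_iff,
    PowerSeries.isUnit_iff_constantCoeff, PowerSeries.constantCoeff_C, PowerSeries.isUnit_iff_constantCoeff,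
    PowerSeries.constantCoeff_X]
  exact not_isUnit_zero

/-- **No power of `T₁` lies in `(p, T₂)`**: the reduction `Λ₂ → 𝔽_p⟦T⟧` killing the INNER variable and `p`
sends `T₁ᴺ` to `Tᴺ ≠ 0`. [folklore] -/
theorem X_pow_notMem_span_p_CX (N : ℕ) :
    (X : IwasawaAlgebra₂ p) ^ N ∉
      Ideal.span ({C (C (p : ℤ_[p])), C X} : Set (IwasawaAlgebra₂ p)) := by
  let φ : IwasawaAlgebra₂ p →+* PowerSeries (IsLocalRing.ResidueField ℤ_[p]) :=
    PowerSeries.map ((IsLocalRing.residue ℤ_[p]).comp (PowerSeries.constantCoeff (R := ℤ_[p])))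
  -- `residue p = 0` (tree: `Rank1Residual.X2.KellerYinFreePartGap.residue_p_eq_zero`; re-derived locally, two lines)
  have hp0 : IsLocalRing.residue ℤ_[p] (p : ℤ_[p]) = 0 := (IsLocalRing.residue_eq_zero_iff _).mpr
    (by rw [PadicInt.maximalIdeal_eq_span_p]; exact Ideal.mem_span_singleton_self _)
  have hker : Ideal.span ({C (C (p : ℤ_[p])), C X} : Set (IwasawaAlgebra₂ p)) ≤ RingHom.ker φ := by
    rw [Ideal.span_le]
    rintro g hg
    rcases hg with rfl | rfl
    · rw [SetLike.mem_coe, RingHom.mem_ker, PowerSeries.map_C, RingHom.comp_apply, PowerSeries.constantCoeff_C,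
        hp0, map_zero]
    · rw [SetLike.mem_coe, RingHom.mem_ker, PowerSeries.map_C, RingHom.comp_apply, PowerSeries.constantCoeff_X,
        map_zero, map_zero]
  intro hmem
  have h0 : φ (X ^ N) = 0 := hker hmem
  rw [map_pow, PowerSeries.map_X] at h0
  exact pow_ne_zero N PowerSeries.X_ne_zero h0

/-- **No power of `T₂` lies in `(p, T₁)`**: the reduction `Λ₂ → 𝔽_p⟦T⟧` killing the OUTER variable and `p`
sends `T₂ᴺ` to `Tᴺ ≠ 0`. [folklore] -/
theorem C_X_pow_notMem_span_p_X (N : ℕ) :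
    (C (X : IwasawaAlgebra p) : IwasawaAlgebra₂ p) ^ N ∉
      Ideal.span ({C (C (p : ℤ_[p])), X} : Set (IwasawaAlgebra₂ p)) := by
  let ψ : IwasawaAlgebra₂ p →+* PowerSeries (IsLocalRing.ResidueField ℤ_[p]) :=
    (PowerSeries.map (IsLocalRing.residue ℤ_[p])).comp (PowerSeries.constantCoeff (R := IwasawaAlgebra p))
  -- `residue p = 0` (tree: `Rank1Residual.X2.KellerYinFreePartGap.residue_p_eq_zero`; re-derived locally, two lines)
  have hp0 : IsLocalRing.residue ℤ_[p] (p : ℤ_[p]) = 0 := (IsLocalRing.residue_eq_zero_iff _).mpr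
    (by rw [PadicInt.maximalIdeal_eq_span_p]; exact Ideal.mem_span_singleton_self _)
  have hker : Ideal.span ({C (C (p : ℤ_[p])), X} : Set (IwasawaAlgebra₂ p)) ≤ RingHom.ker ψ := by
    rw [Ideal.span_le]
    rintro g hg
    rcases hg with rfl | rfl
    · rw [SetLike.mem_coe, RingHom.mem_ker, RingHom.comp_apply, PowerSeries.constantCoeff_C, PowerSeries.map_C,
        hp0, map_zero]
    · rw [SetLike.mem_coe, RingHom.mem_ker, RingHom.comp_apply, PowerSeries.constantCoeff_X, map_zero]
  intro hmem
  have h0 : ψ (C X ^ N) = 0 := hker hmem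
  rw [map_pow, RingHom.comp_apply, PowerSeries.constantCoeff_C, PowerSeries.map_X] at h0
  exact pow_ne_zero N PowerSeries.X_ne_zero h0

/-- **`p = C (C p)` is a prime element of `Λ₂`** (twice the tree's `prime_C_of_prime` over `ℤ_p`). [folklore] -/
theorem prime_C_C_p : Prime (C (C (p : ℤ_[p])) : IwasawaAlgebra₂ p) :=
  prime_C_of_prime (IwasawaAlgebra.prime_C p)

/-- The ideal `(p) ⊂ Λ₂` is prime. [folklore] -/
theorem isPrime_span_C_C_p : (Ideal.span {C (C (p : ℤ_[p]))} : Ideal (IwasawaAlgebra₂ p)).IsPrime :=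
  (Ideal.span_singleton_prime (prime_C_C_p p).ne_zero).mpr (prime_C_C_p p)

/-- The ideal `(p) ⊂ Λ₂` has height one (the prime of the `μ`-invariant in two variables). [folklore] -/
theorem height_span_C_C_p : (Ideal.span {C (C (p : ℤ_[p]))} : Ideal (IwasawaAlgebra₂ p)).height = 1 :=
  Module.height_span_singleton_eq_one_of_prime (prime_C_C_p p)

/-- `(p) ≤ (p, T₂)`. [folklore] -/
theorem span_C_C_p_le_span_p_CX :
    (Ideal.span {C (C (p : ℤ_[p]))} : Ideal (IwasawaAlgebra₂ p)) ≤
      Ideal.span ({C (C (p : ℤ_[p])), C X} : Set (IwasawaAlgebra₂ p)) :=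
  Ideal.span_mono (Set.singleton_subset_iff.mpr (Set.mem_insert _ _))

/-- `(p) ≤ (p, T₁)`. [folklore] -/
theorem span_C_C_p_le_span_p_X :
    (Ideal.span {C (C (p : ℤ_[p]))} : Ideal (IwasawaAlgebra₂ p)) ≤
      Ideal.span ({C (C (p : ℤ_[p])), X} : Set (IwasawaAlgebra₂ p)) :=
  Ideal.span_mono (Set.singleton_subset_iff.mpr (Set.mem_insert _ _))

end TwoVar

/-! ## §3 The line lift for a finitely generated `Λ₂`-module -/

section Module

variable (p : ℕ) [Fact p.Prime] {M : Type*} [AddCommGroup M] [Module (IwasawaAlgebra₂ p) M]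
  [Module.Finite (IwasawaAlgebra₂ p) M]

open PowerSeries

/-- **LINE LIFT along `T₂ = 0`.** `M` finitely generated over `Λ₂` with `M/(p, T₂)M` finite ⇒ some `h ∉ (p, T₂)`
kills `M`. [cite: Matsumura1987, Thm. 2.1 and Thm. 2.2] -/
theorem exists_notMem_smul_eq_zero_of_finite_quotient_p_CX
    [Finite (M ⧸ ((Ideal.span ({C (C (p : ℤ_[p])), C X} : Set (IwasawaAlgebra₂ p))) •
      (⊤ : Submodule (IwasawaAlgebra₂ p) M)))] :
    ∃ h : IwasawaAlgebra₂ p,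
      h ∉ Ideal.span ({C (C (p : ℤ_[p])), C X} : Set (IwasawaAlgebra₂ p)) ∧ ∀ m : M, h • m = 0 :=
  exists_notMem_smul_eq_zero_of_finite_quotient _ (X_mem_jacobson_bot p) (X_pow_notMem_span_p_CX p)

/-- **LINE LIFT along `T₁ = 0`.** `M` finitely generated over `Λ₂` with `M/(p, T₁)M` finite ⇒ some `h ∉ (p, T₁)`
kills `M`. [cite: Matsumura1987, Thm. 2.1 and Thm. 2.2] -/
theorem exists_notMem_smul_eq_zero_of_finite_quotient_p_X
    [Finite (M ⧸ ((Ideal.span ({C (C (p : ℤ_[p])), X} : Set (IwasawaAlgebra₂ p))) •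
      (⊤ : Submodule (IwasawaAlgebra₂ p) M)))] :
    ∃ h : IwasawaAlgebra₂ p,
      h ∉ Ideal.span ({C (C (p : ℤ_[p])), X} : Set (IwasawaAlgebra₂ p)) ∧ ∀ m : M, h • m = 0 :=
  exists_notMem_smul_eq_zero_of_finite_quotient _ (C_X_mem_jacobson_bot p) (C_X_pow_notMem_span_p_X p)

/-- **Torsion from the line `T₂ = 0`**: `M/(p, T₂)M` finite ⇒ `M` is `Λ₂`-torsion. [cite: Matsumura1987, Thm. 2.1] -/
theorem isTorsion_of_finite_quotient_p_CX
    [Finite (M ⧸ ((Ideal.span ({C (C (p : ℤ_[p])), C X} : Set (IwasawaAlgebra₂ p))) •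
      (⊤ : Submodule (IwasawaAlgebra₂ p) M)))] :
    Module.IsTorsion (IwasawaAlgebra₂ p) M := by
  obtain ⟨h, hh, hM⟩ := exists_notMem_smul_eq_zero_of_finite_quotient_p_CX p (M := M)
  exact isTorsion_of_smul_eq_zero (fun h0 => hh (by rw [h0]; exact Ideal.zero_mem _)) hM

/-- **Torsion from the line `T₁ = 0`**: `M/(p, T₁)M` finite ⇒ `M` is `Λ₂`-torsion. [cite: Matsumura1987, Thm. 2.1] -/
theorem isTorsion_of_finite_quotient_p_X
    [Finite (M ⧸ ((Ideal.span ({C (C (p : ℤ_[p])), X} : Set (IwasawaAlgebra₂ p))) •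
      (⊤ : Submodule (IwasawaAlgebra₂ p) M)))] :
    Module.IsTorsion (IwasawaAlgebra₂ p) M := by
  obtain ⟨h, hh, hM⟩ := exists_notMem_smul_eq_zero_of_finite_quotient_p_X p (M := M)
  exact isTorsion_of_smul_eq_zero (fun h0 => hh (by rw [h0]; exact Ideal.zero_mem _)) hM

/-- **`μ_{Λ₂}(M) = 0` from the line `T₂ = 0`**: `M/(p, T₂)M` finite ⇒ `M_{(p)} = 0`, i.e. the local length of
`M` at the height-one prime `(p)` of `Λ₂` vanishes. [cite: Washington1997, §13.2] [cite: Matsumura1987, Thm. 2.1] -/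
theorem lengthAt_span_p_eq_zero_of_finite_quotient_p_CX
    [Finite (M ⧸ ((Ideal.span ({C (C (p : ℤ_[p])), C X} : Set (IwasawaAlgebra₂ p))) •
      (⊤ : Submodule (IwasawaAlgebra₂ p) M)))] :
    Module.lengthAt (IwasawaAlgebra₂ p) M ⟨Ideal.span {C (C (p : ℤ_[p]))}, isPrime_span_C_C_p p⟩ = 0 := by
  obtain ⟨h, hh, hM⟩ := exists_notMem_smul_eq_zero_of_finite_quotient_p_CX p (M := M)
  exact lengthAt_eq_zero_of_smul_eq_zero_of_notMem _ (fun h' => hh (span_C_C_p_le_span_p_CX p h')) hM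

/-- **`μ_{Λ₂}(M) = 0` from the line `T₁ = 0`**: `M/(p, T₁)M` finite ⇒ `M_{(p)} = 0`.
[cite: Washington1997, §13.2] [cite: Matsumura1987, Thm. 2.1] -/
theorem lengthAt_span_p_eq_zero_of_finite_quotient_p_X
    [Finite (M ⧸ ((Ideal.span ({C (C (p : ℤ_[p])), X} : Set (IwasawaAlgebra₂ p))) •
      (⊤ : Submodule (IwasawaAlgebra₂ p) M)))] :
    Module.lengthAt (IwasawaAlgebra₂ p) M ⟨Ideal.span {C (C (p : ℤ_[p]))}, isPrime_span_C_C_p p⟩ = 0 := by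
  obtain ⟨h, hh, hM⟩ := exists_notMem_smul_eq_zero_of_finite_quotient_p_X p (M := M)
  exact lengthAt_eq_zero_of_smul_eq_zero_of_notMem _ (fun h' => hh (span_C_C_p_le_span_p_X p h')) hM

/-- **`ch_{Λ₂}(M) ⊄ (p)` from the line `T₂ = 0`.** [cite: Washington1997, §13.2] -/
theorem not_charIdeal_le_span_p_of_finite_quotient_p_CX
    [Finite (M ⧸ ((Ideal.span ({C (C (p : ℤ_[p])), C X} : Set (IwasawaAlgebra₂ p))) •
      (⊤ : Submodule (IwasawaAlgebra₂ p) M)))] :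
    ¬ Module.charIdeal (IwasawaAlgebra₂ p) M ≤ Ideal.span {C (C (p : ℤ_[p]))} := by
  obtain ⟨h, hh, hM⟩ := exists_notMem_smul_eq_zero_of_finite_quotient_p_CX p (M := M)
  exact not_charIdeal_le_of_smul_eq_zero_of_notMem (𝔮 := ⟨_, isPrime_span_C_C_p p⟩) (height_span_C_C_p p)
    (fun h' => hh (span_C_C_p_le_span_p_CX p h')) hM

/-- **`ch_{Λ₂}(M) ⊄ (p)` from the line `T₁ = 0`.** [cite: Washington1997, §13.2] -/
theorem not_charIdeal_le_span_p_of_finite_quotient_p_X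
    [Finite (M ⧸ ((Ideal.span ({C (C (p : ℤ_[p])), X} : Set (IwasawaAlgebra₂ p))) •
      (⊤ : Submodule (IwasawaAlgebra₂ p) M)))] :
    ¬ Module.charIdeal (IwasawaAlgebra₂ p) M ≤ Ideal.span {C (C (p : ℤ_[p]))} := by
  obtain ⟨h, hh, hM⟩ := exists_notMem_smul_eq_zero_of_finite_quotient_p_X p (M := M)
  exact not_charIdeal_le_of_smul_eq_zero_of_notMem (𝔮 := ⟨_, isPrime_span_C_C_p p⟩) (height_span_C_C_p p)
    (fun h' => hh (span_C_C_p_le_span_p_X p h')) hM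

end Module

end Summit.BirchSwinnertonDyer.BirchSwinnertonDyer.Theorems.TwoAdicBDPLineLift

end
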